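import Summits.HodgeConjecture.CorCM.IrreducibleOddWeightsIndexParityCMFields
import HarnessLib

/-!
# Index parity, VI: the defect is a function of the PAIR of shadows; RANK-ONE MODELS — non-parallel moment functionals
# give disjoint coefficient spaces; the 2-adic obstruction behind «odd × odd indices stay additive» over a D₄ reflex pair

COR-CM (cell `pub-hodgecm2`, binder seat `b16` gen 68, count-neutral claim INDEX PARITY, file P5 — abstract `G`-set level
(§1, §3), CM fields (§2), integers (§4); theorems only, no definition, no named fact, no `sorry`).  NEW as stated, hence
under `Summits/`.  HONEST FRAMING: finite-dimensional linear algebra about the Kubota–Dodson rank of a pair of CM types and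
elementary arithmetic; the D₄ statement of §4 is the arithmetic half of a MODEL computation (the Galois action of a concrete
pair of fields on the model is for the user to verify); `HC_CM` is neither used nor asserted.

* §1 **TWO-SIDED FINE PIVOTS** (abstract): pivots `r₀ : E₀ → Y₀`, `r₁ : E₁ → Y₁` refining the `PW₁`- resp. `PW₀`-orbits
  ⟹ **`MC₀ ∩ MC₁ = F₀^{r₀} ∩ F₁^{r₁}`** (`IrrOdd.span_coeff_inf_eq_span_fibreSum_inf_span_fibreSum_of_fine`; P1 gave the
  one-sided form) and, for equivariant pivots, `= span{g ↦ w₀(g·y)} ∩ span{g ↦ w₁(g·y′)}`: **the defect is a function of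
  the PAIR OF SHADOWS** (`IrrOdd.typeRank_add_typeRank_eq_add_finrank_shadowCoeff_inf_shadowCoeff_of_fine`).
* §2 CM dress (`cmTypeRank_add_cmTypeRank_eq_cmFamilyRank_add_one_add_finrank_shadow_inf_shadow`): subfields
  `T₀ ⊆ K_{i₀}`, `T₁ ⊆ K_{i₁}` containing the traces `K_{i₀} ∩ L₁`, `K_{i₁} ∩ L₀` ⟹
  `dim Hg(A₀)+dim Hg(A₁)−dim Hg(A₀×A₁) = dim(S(w₀) ∩ S(w₁))` — the numerics of this generation (kit j236433: the defect
  is constant on shadow pairs in all 160 000+ type pairs) as a theorem.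
* §3 **RANK-ONE MODELS** (abstract): if the shadow translates are MATRIX COEFFICIENTS `g ↦ φ_κ(g·v)` of a linear action
  on a `ℚ`-space `V` with row functionals `φ₀, φ₁` (the shadow "factors through a moment functional"), and the matrix
  coefficients of `V` SEPARATE rank-one tensors (`φ(g·v) = φ′(g·v′) ∀g ⟹ v = 0 ∨ φ ∈ ℚφ′` — absolute irreducibility), then
  **non-parallel moment functionals give DISJOINT coefficient spaces** (`IrrOdd.span_inf_span_eq_bot_of_not_parallel`):
  the mechanism of POSITIONAL additivity (`AA ∧ ¬PC`).
* §4 **THE 2-ADIC OBSTRUCTION** (`not_parallel_of_odd`): for odd integers `α, β, a, b` the vectors `(α, β)` and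
  `(a + b, a − b)` are NOT parallel over `ℚ`.  In the D₄ model (`Y₀ = {±e₁, ±e₂}`, `Y₁ = {±(e₁+e₂), ±(e₁−e₂)}`, `ρ = −1`)
  the moment functional of an odd weight `w₀` on `Y₀` is `(w₀(e₁), w₀(e₂))` and that of `w₁` on `Y₁` is
  `((w₁(e₁+e₂)+w₁(e₁−e₂))/2, (w₁(e₁+e₂)−w₁(e₁−e₂))/2)`; shadows of ODD index have odd entries (P2
  `shadow_ne_zero_of_odd_finrank` / P1 parity), so over the D₄ reflex pair two CM fields of ODD indices over their traces
  are additive for ALL types although (PC) fails — the census of this generation (`(T₀F, T₁F′)`, indices (3,3), (1,5),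
  (3,5): 0 interacting pairs; any even index: interaction) as arithmetic.

## References

* [Gordon1999HodgeAVSurvey] B. B. Gordon, *A survey of the Hodge conjecture for abelian varieties*, §3 Theorem (proof),
  7.5–7.7, 9.4.3.
* [Serre1977] J.-P. Serre, *Linear Representations of Finite Groups*, GTM 42, §2.2 (matrix coefficients), §3.3.
* [Lang2002] S. Lang, *Algebra*, 3rd ed., XVII §3 (Burnside / density: matrix coefficients of an absolutely irreducible
  module), VI §1.
* [Shimura1998] G. Shimura, *Abelian Varieties with Complex Multiplication and Modular Functions*, §8.1, §8.4 (reflex of a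
  quartic CM type).
-/

set_option autoImplicit false

noncomputable section

open scoped BigOperators Classical

universe u v v' v'' w

/-! ### §1 Two-sided fine pivots: the defect is a function of the pair of shadows -/

namespace Summit.HodgeConjecture.CorCM.IrrOdd

open Literature.NumberTheory.ComplexMultiplication

variable {G : Type w} [Group G]

section TwoSided

variable {I : Type u} {E : I → Type v} [∀ i, MulAction G (E i)] [∀ i, Fintype (E i)]
  {Y₀ : Type v'} [DecidableEq Y₀] {Y₁ : Type v''} [DecidableEq Y₁]

/-- **`MC₀ ∩ MC₁ = F₀^{r₀} ∩ F₁^{r₁}`** for any two pivots refining the trace classes of their slots (P1's one-sided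
form applied in both orders; `F_κ ≤ MC_κ`). [cite: Gordon1999HodgeAVSurvey, §3 Theorem (proof)] [cite: Serre1977, §3.3] -/
theorem span_coeff_inf_eq_span_fibreSum_inf_span_fibreSum_of_fine (Φ : ∀ i, Set (E i)) {i₀ i₁ : I}
    (r₀ : E i₀ → Y₀) (r₁ : E i₁ → Y₁)
    (hfine₀ : ∀ x x' : E i₀, r₀ x = r₀ x' → ∃ n : G, (∀ y : E i₁, n • y = y) ∧ n • x = x')
    (hfine₁ : ∀ x x' : E i₁, r₁ x = r₁ x' → ∃ n : G, (∀ y : E i₀, n • y = y) ∧ n • x = x') :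
    Submodule.span ℚ (Set.range fun x : E i₀ => fun g : G => antiVec (Φ i₀) g x) ⊓
        Submodule.span ℚ (Set.range fun x : E i₁ => fun g : G => antiVec (Φ i₁) g x) =
      Submodule.span ℚ (Set.range fun y : Y₀ => fun g : G =>
          ∑ x ∈ Finset.univ.filter (fun x => r₀ x = y), antiVec (Φ i₀) g x) ⊓
        Submodule.span ℚ (Set.range fun y : Y₁ => fun g : G =>
          ∑ x ∈ Finset.univ.filter (fun x => r₁ x = y), antiVec (Φ i₁) g x) := by
  have h0 := span_coeff_inf_eq_span_fibreSum_inf_span_coeff_of_fine Φ r₀ hfine₀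
  have h1 := span_coeff_inf_eq_span_fibreSum_inf_span_coeff_of_fine Φ r₁ hfine₁
  refine le_antisymm ?_ (inf_le_inf (span_fibreSum_le_span_coeff (G := G) (Φ i₀) r₀)
    (span_fibreSum_le_span_coeff (G := G) (Φ i₁) r₁))
  intro c hc
  have hc' : c ∈ Submodule.span ℚ (Set.range fun x : E i₁ => fun g : G => antiVec (Φ i₁) g x) ⊓
      Submodule.span ℚ (Set.range fun x : E i₀ => fun g : G => antiVec (Φ i₀) g x) := by
    rw [inf_comm]; exact hc
  rw [h0] at hc
  rw [h1] at hc'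
  exact ⟨hc.1, hc'.1⟩

variable [MulAction G Y₀] [MulAction G Y₁] [Fintype I] [∀ i, Nonempty (E i)]

/-- **THE DEFECT IS A FUNCTION OF THE PAIR OF SHADOWS**:
`rank Φ₀ + rank Φ₁ = rank(Φ₀,Φ₁) + 1 + dim(span{g ↦ w₀(g·y)} ∩ span{g ↦ w₁(g·y′)})` for equivariant pivots of both slots
refining the trace classes. [cite: Gordon1999HodgeAVSurvey, §3 Theorem, 7.5–7.7 and 9.4.3] -/
theorem typeRank_add_typeRank_eq_add_finrank_shadowCoeff_inf_shadowCoeff_of_fine {ρ : G} {Φ : ∀ i, Set (E i)}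
    (h : ∀ i, IsCMTypeWith ρ (Φ i)) {i₀ i₁ : I} (hI : ∀ j, j = i₀ ∨ j = i₁) (h01 : i₀ ≠ i₁)
    (r₀ : E i₀ → Y₀) (r₁ : E i₁ → Y₁) (hr₀ : ∀ (g : G) (x : E i₀), r₀ (g • x) = g • r₀ x)
    (hr₁ : ∀ (g : G) (x : E i₁), r₁ (g • x) = g • r₁ x)
    (hfine₀ : ∀ x x' : E i₀, r₀ x = r₀ x' → ∃ n : G, (∀ y : E i₁, n • y = y) ∧ n • x = x')
    (hfine₁ : ∀ x x' : E i₁, r₁ x = r₁ x' → ∃ n : G, (∀ y : E i₀, n • y = y) ∧ n • x = x') :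
    typeRank G (Φ i₀) + typeRank G (Φ i₁) = typeRank G (sigmaType Φ) + 1 +
      Module.finrank ℚ (Submodule.span ℚ (Set.range fun y : Y₀ => fun g : G =>
            ∑ x ∈ Finset.univ.filter (fun x => r₀ x = g • y), antiVec (Φ i₀) (1 : G) x) ⊓
          Submodule.span ℚ (Set.range fun y : Y₁ => fun g : G =>
            ∑ x ∈ Finset.univ.filter (fun x => r₁ x = g • y), antiVec (Φ i₁) (1 : G) x) : Submodule ℚ (G → ℚ)) := by
  rw [typeRank_add_typeRank_eq_of_pair h hI h01,
    span_coeff_inf_eq_span_fibreSum_inf_span_fibreSum_of_fine Φ r₀ r₁ hfine₀ hfine₁,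
    span_fibreSum_eq_span_shadowCoeff (Φ i₀) r₀ hr₀, span_fibreSum_eq_span_shadowCoeff (Φ i₁) r₁ hr₁]

end TwoSided

/-! ### §3 Rank-one models: non-parallel moment functionals give disjoint coefficient spaces -/

section RankOne

variable {V : Type v} [AddCommGroup V] [Module ℚ V]

/-- A combination of matrix coefficients with a fixed row `φ` is a matrix coefficient with row `φ`:
`Σ_j μ_j φ(g·v_j) = φ(g·Σ_j μ_j v_j)`; so `span{g ↦ φ(g·v) : v ∈ S}` consists of such coefficients.
[cite: Serre1977, §2.2] -/
theorem exists_eq_coeff_of_mem_span (act : G →* V →ₗ[ℚ] V) (φ : Module.Dual ℚ V) {S : Set V} {c : G → ℚ}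
    (hc : c ∈ Submodule.span ℚ ((fun v : V => fun g : G => φ (act g v)) '' S)) :
    ∃ v : V, c = fun g : G => φ (act g v) := by
  induction hc using Submodule.span_induction with
  | mem c hc =>
    obtain ⟨v, -, rfl⟩ := hc
    exact ⟨v, rfl⟩
  | zero => exact ⟨0, funext fun g => by simp⟩
  | add c c' _ _ hc hc' =>
    obtain ⟨v, rfl⟩ := hc
    obtain ⟨v', rfl⟩ := hc'
    exact ⟨v + v', funext fun g => by simp⟩
  | smul a c _ hc =>
    obtain ⟨v, rfl⟩ := hc
    exact ⟨a • v, funext fun g => by simp⟩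

/-- **NON-PARALLEL MOMENT FUNCTIONALS GIVE DISJOINT COEFFICIENT SPACES.**  Let `G` act linearly on `V` and let the matrix
coefficients of `V` separate rank-one tensors (`φ(g·v) = φ′(g·v′)` for all `g` forces `v = 0` or `φ ∈ ℚφ′`: absolute
irreducibility, Burnside).  If `φ₀ ∉ ℚφ₁` then `span{g ↦ φ₀(g·v)} ∩ span{g ↦ φ₁(g·v′)} = 0` — two slots whose shadow
translates are matrix coefficients with NON-PARALLEL rows are additive, whatever the common constituent.
[cite: Lang2002, XVII §3] [cite: Serre1977, §2.2] -/
theorem span_inf_span_eq_bot_of_not_parallel (act : G →* V →ₗ[ℚ] V)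
    (hsep : ∀ (φ φ' : Module.Dual ℚ V) (v v' : V), (∀ g : G, φ (act g v) = φ' (act g v')) →
      v = 0 ∨ ∃ t : ℚ, φ = t • φ')
    {φ₀ φ₁ : Module.Dual ℚ V} (hnp : ∀ t : ℚ, φ₀ ≠ t • φ₁) (S₀ S₁ : Set V) :
    Submodule.span ℚ ((fun v : V => fun g : G => φ₀ (act g v)) '' S₀) ⊓
        Submodule.span ℚ ((fun v : V => fun g : G => φ₁ (act g v)) '' S₁) = ⊥ := by
  rw [Submodule.eq_bot_iff]
  rintro c ⟨hc₀, hc₁⟩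
  obtain ⟨v, rfl⟩ := exists_eq_coeff_of_mem_span act φ₀ hc₀
  obtain ⟨v', hv'⟩ := exists_eq_coeff_of_mem_span act φ₁ hc₁
  rcases hsep φ₀ φ₁ v v' (fun g => congrFun hv' g) with hv | ⟨t, ht⟩
  · funext g
    simp [hv]
  · exact absurd ht (hnp t)

/-- **THE D₄ SEPARATION LEMMA.**  If the linear action contains two operators `R`, `S` acting on a pair `e₁, e₂` spanning
`V` with `R e₁ = e₂`, `R e₂ = −e₁`, `S e₁ = e₁`, `S e₂ = −e₂` (the rotation and a reflection of the square: the faithful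
plane representation of the dihedral group of order 8), then the matrix coefficients separate rank-one tensors: from the
values at `1, R, S, RS` one reads off `xφ(e₁), yφ(e₂), xφ(e₂), yφ(e₁)` for `v = x e₁ + y e₂` (no independence of
`e₁, e₂` is needed).
[cite: Serre1977, §2.2 and §5.3] [cite: Lang2002, XVII §3] -/
theorem separate_of_dihedral (act : G →* V →ₗ[ℚ] V) {e₁ e₂ : V} (hspan : ∀ v : V, ∃ x y : ℚ, v = x • e₁ + y • e₂)
    {gR gS : G}
    (hR₁ : act gR e₁ = e₂) (hR₂ : act gR e₂ = -e₁) (hS₁ : act gS e₁ = e₁) (hS₂ : act gS e₂ = -e₂)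
    (φ φ' : Module.Dual ℚ V) (v v' : V) (hcoef : ∀ g : G, φ (act g v) = φ' (act g v')) :
    v = 0 ∨ ∃ t : ℚ, φ = t • φ' := by
  obtain ⟨x, y, rfl⟩ := hspan v
  obtain ⟨x', y', rfl⟩ := hspan v'
  -- the four readings
  have h1 := hcoef 1
  have hR := hcoef gR
  have hS := hcoef gS
  have hRS := hcoef (gR * gS)
  simp only [map_one, Module.End.one_apply, map_add, map_smul, map_mul, Module.End.mul_apply, hR₁, hR₂, hS₁, hS₂,
    map_neg, neg_neg, smul_eq_mul] at h1 hR hS hRS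
  -- `p = φ e₁`, `q = φ e₂`: xp = x'p', yq = y'q', xq = x'q', yp = y'p'
  have e_px : x * φ e₁ = x' * φ' e₁ := by linarith
  have e_qy : y * φ e₂ = y' * φ' e₂ := by linarith
  have e_qx : x * φ e₂ = x' * φ' e₂ := by linarith
  have e_py : y * φ e₁ = y' * φ' e₁ := by linarith
  by_cases hx : x = 0
  · by_cases hy : y = 0
    · left
      rw [hx, hy, zero_smul, zero_smul, add_zero]
    · right
      refine ⟨y' / y, LinearMap.ext fun u => ?_⟩
      obtain ⟨a, b, rfl⟩ := hspan u
      simp only [map_add, map_smul, LinearMap.smul_apply, smul_eq_mul]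
      field_simp
      linear_combination a * e_py + b * e_qy
  · right
    refine ⟨x' / x, LinearMap.ext fun u => ?_⟩
    obtain ⟨a, b, rfl⟩ := hspan u
    simp only [map_add, map_smul, LinearMap.smul_apply, smul_eq_mul]
    field_simp
    linear_combination a * e_px + b * e_qx


/-- **POSITIONAL ADDITIVITY FROM A RANK-ONE MODEL**: if the shadow translates of both slots are matrix coefficients
`g ↦ φ_κ(g·e_κ(y))` of ONE linear action whose coefficients separate rank-one tensors, with NON-PARALLEL rows `φ₀ ∉ ℚφ₁`,
then `rank(Φ₀,Φ₁) + 2 = rank Φ₀ + rank Φ₁ + 1` — the pair is ADDITIVE although the two slots share the constituent `V`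
(the mechanism of `AA ∧ ¬PC`). [cite: Gordon1999HodgeAVSurvey, §3 Theorem, 7.5–7.7] [cite: Lang2002, XVII §3] -/
theorem typeRank_sigmaType_add_card_eq_of_moment_not_parallel {I : Type u} {E : I → Type v} [∀ i, MulAction G (E i)]
    [∀ i, Fintype (E i)] [Fintype I] [∀ i, Nonempty (E i)] {Y₀ : Type v'} [DecidableEq Y₀] [MulAction G Y₀]
    {Y₁ : Type v''} [DecidableEq Y₁] [MulAction G Y₁] {ρ : G} {Φ : ∀ i, Set (E i)} (h : ∀ i, IsCMTypeWith ρ (Φ i))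
    {i₀ i₁ : I} (hI : ∀ j, j = i₀ ∨ j = i₁) (h01 : i₀ ≠ i₁) (r₀ : E i₀ → Y₀) (r₁ : E i₁ → Y₁)
    (hr₀ : ∀ (g : G) (x : E i₀), r₀ (g • x) = g • r₀ x) (hr₁ : ∀ (g : G) (x : E i₁), r₁ (g • x) = g • r₁ x)
    (hfine₀ : ∀ x x' : E i₀, r₀ x = r₀ x' → ∃ n : G, (∀ y : E i₁, n • y = y) ∧ n • x = x')
    (hfine₁ : ∀ x x' : E i₁, r₁ x = r₁ x' → ∃ n : G, (∀ y : E i₀, n • y = y) ∧ n • x = x')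
    (act : G →* V →ₗ[ℚ] V)
    (hsep : ∀ (φ φ' : Module.Dual ℚ V) (v v' : V), (∀ g : G, φ (act g v) = φ' (act g v')) →
      v = 0 ∨ ∃ t : ℚ, φ = t • φ')
    {φ₀ φ₁ : Module.Dual ℚ V} (hnp : ∀ t : ℚ, φ₀ ≠ t • φ₁) (e₀ : Y₀ → V) (e₁ : Y₁ → V)
    (hw₀ : ∀ (y : Y₀) (g : G), ∑ x ∈ Finset.univ.filter (fun x => r₀ x = g • y), antiVec (Φ i₀) (1 : G) x =
      φ₀ (act g (e₀ y)))
    (hw₁ : ∀ (y : Y₁) (g : G), ∑ x ∈ Finset.univ.filter (fun x => r₁ x = g • y), antiVec (Φ i₁) (1 : G) x =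
      φ₁ (act g (e₁ y))) :
    typeRank G (sigmaType Φ) + Fintype.card I = (∑ i, typeRank G (Φ i)) + 1 := by
  have hcard : Fintype.card I = 2 := by
    rw [← Finset.card_univ, show (Finset.univ : Finset I) = {i₀, i₁} from Finset.ext fun j => by
      simpa only [Finset.mem_univ, Finset.mem_insert, Finset.mem_singleton, true_iff] using hI j,
      Finset.card_pair h01]
  have hpair := typeRank_add_typeRank_eq_add_finrank_shadowCoeff_inf_shadowCoeff_of_fine h hI h01 r₀ r₁ hr₀ hr₁
    hfine₀ hfine₁
  -- the two shadow-coefficient spaces are row-coefficient spaces of the model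
  have hS₀ : (Set.range fun y : Y₀ => fun g : G =>
      ∑ x ∈ Finset.univ.filter (fun x => r₀ x = g • y), antiVec (Φ i₀) (1 : G) x) =
        (fun v : V => fun g : G => φ₀ (act g v)) '' Set.range e₀ := by
    ext c
    simp only [Set.mem_range, Set.mem_image, exists_exists_eq_and]
    constructor
    · rintro ⟨y, rfl⟩
      exact ⟨y, funext fun g => (hw₀ y g).symm⟩
    · rintro ⟨y, rfl⟩
      exact ⟨y, funext fun g => hw₀ y g⟩
  have hS₁ : (Set.range fun y : Y₁ => fun g : G =>
      ∑ x ∈ Finset.univ.filter (fun x => r₁ x = g • y), antiVec (Φ i₁) (1 : G) x) =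
        (fun v : V => fun g : G => φ₁ (act g v)) '' Set.range e₁ := by
    ext c
    simp only [Set.mem_range, Set.mem_image, exists_exists_eq_and]
    constructor
    · rintro ⟨y, rfl⟩
      exact ⟨y, funext fun g => (hw₁ y g).symm⟩
    · rintro ⟨y, rfl⟩
      exact ⟨y, funext fun g => hw₁ y g⟩
  rw [hS₀, hS₁, span_inf_span_eq_bot_of_not_parallel act hsep hnp, finrank_bot, add_zero] at hpair
  rw [sum_eq_add_of_pair _ hI h01, hcard]
  omega

end RankOne

end Summit.HodgeConjecture.CorCM.IrrOdd

/-! ### §4 The 2-adic obstruction -/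

namespace Summit.HodgeConjecture.CorCM

/-- **THE 2-ADIC OBSTRUCTION**: for ODD integers `α, β, a, b` the vectors `(α, β)` and `(a + b, a − b)` are not parallel
over `ℚ` — in the D₄ model, the moment functional `(w₀(e₁), w₀(e₂))` of an odd-index shadow on `Y₀ = {±e₁, ±e₂}` is never
parallel to the moment functional of an odd-index shadow on `Y₁ = {±(e₁+e₂), ±(e₁−e₂)}` (whose coordinates are
`((a+b)/2, (a−b)/2)`), so by §3 the two coefficient spaces are disjoint: odd × odd indices over the D₄ reflex pair are
additive for all types. [cite: Shimura1998, §8.4] [cite: Gordon1999HodgeAVSurvey, 9.4.3] -/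
theorem not_parallel_of_odd {α β a b : ℤ} (hα : Odd α) (hβ : Odd β) (ha : Odd a) (hb : Odd b) (t : ℚ) :
    ¬ ((α : ℚ) = t * (a + b) ∧ (β : ℚ) = t * (a - b)) := by
  rintro ⟨h1, h2⟩
  obtain ⟨α', rfl⟩ := hα
  obtain ⟨β', rfl⟩ := hβ
  obtain ⟨a', rfl⟩ := ha
  obtain ⟨b', rfl⟩ := hb
  -- `s = α' + β' + 1`, `d = α' − β'`: `α + β = 2s`, `α − β = 2d`; `2s = 2ta`, `2d = 2tb` ⟹ `s·b = d·a` in `ℚ`, hence in `ℤ`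
  have hs : ((α' + β' + 1 : ℤ) : ℚ) = t * (2 * a' + 1) := by push_cast at h1 h2 ⊢; linarith
  have hd : ((α' - β' : ℤ) : ℚ) = t * (2 * b' + 1) := by push_cast at h1 h2 ⊢; linarith
  have hcross : ((α' + β' + 1) * (2 * b' + 1) : ℤ) = (α' - β') * (2 * a' + 1) := by
    have : ((α' + β' + 1 : ℤ) : ℚ) * (2 * b' + 1) = ((α' - β' : ℤ) : ℚ) * (2 * a' + 1) := by
      rw [hs, hd]; ring
    exact_mod_cast this
  -- parity: the left side has the parity of `α' + β' + 1`, the right side that of `α' − β'`; these differ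
  have h2 : (2 : ℤ) ∣ ((α' + β' + 1) * (2 * b' + 1) - (α' - β') * (2 * a' + 1)) := by
    rw [hcross, sub_self]; exact dvd_zero 2
  have key : (α' + β' + 1) * (2 * b' + 1) - (α' - β') * (2 * a' + 1) =
      2 * ((α' + β' + 1) * b' - (α' - β') * a' + β') + 1 := by ring
  rw [key] at h2
  omega

/-- Coordinate form used with §3: `(α, β) = t·((a+b)/2·2, …)` — if `φ₀(e₁) = α`, `φ₀(e₂) = β` and `φ₁(e₁+e₂) = a`,
`φ₁(e₁−e₂) = b` with all four odd integers, then `φ₀ ≠ t·φ₁` for every `t`. [cite: Gordon1999HodgeAVSurvey, 9.4.3] -/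
theorem dual_ne_smul_of_odd {V : Type*} [AddCommGroup V] [Module ℚ V] {e₁ e₂ : V} {φ₀ φ₁ : Module.Dual ℚ V}
    {α β a b : ℤ} (hα : Odd α) (hβ : Odd β) (ha : Odd a) (hb : Odd b) (h0₁ : φ₀ e₁ = α) (h0₂ : φ₀ e₂ = β)
    (h1₁ : φ₁ (e₁ + e₂) = a) (h1₂ : φ₁ (e₁ - e₂) = b) (t : ℚ) : φ₀ ≠ t • φ₁ := by
  intro h
  apply not_parallel_of_odd hα hβ ha hb (t / 2)
  have hp : φ₀ e₁ = t * φ₁ e₁ := by rw [h]; rfl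
  have hq : φ₀ e₂ = t * φ₁ e₂ := by rw [h]; rfl
  rw [map_add] at h1₁
  rw [map_sub] at h1₂
  have hφ1 : φ₁ e₁ = ((a : ℚ) + b) / 2 := by linarith
  have hφ2 : φ₁ e₂ = ((a : ℚ) - b) / 2 := by linarith
  constructor
  · rw [← h0₁, hp, hφ1]; ring
  · rw [← h0₂, hq, hφ2]; ring


/-! ### §2 (CM fields) The defect as a function of the pair of shadows -/

section CM

open CategoryTheory NumberField Module IntermediateField
open Literature.NumberTheory.ComplexMultiplication
open Literature.AlgebraicGeometry.Motives (CMType)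
open Literature.AlgebraicGeometry.Pohlmann1968

variable {I : Type} [Fintype I] {K : I → Type} [∀ i, Field (K i)] [∀ i, NumberField (K i)] [∀ i, IsCMField (K i)]
  {T₀ : Type} [Field T₀] {T₁ : Type} [Field T₁]

/-- **THE DEFECT IS A FUNCTION OF THE PAIR OF SHADOWS (CM fields)**: for subfields `T₀ ⊆ K_{i₀}`, `T₁ ⊆ K_{i₁}`
containing the traces `K_{i₀} ∩ L₁` resp. `K_{i₁} ∩ L₀`,
`cmTypeRank Φ₀ + cmTypeRank Φ₁ = cmFamilyRank Φ + 1 + dim(S(w₀) ∩ S(w₁))`, `S(w_κ) = span{g ↦ w_κ(g ∘ y)}` the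
matrix-coefficient space of the shadow `w_κ` of `Φ_κ` on `Hom(T_κ, ℂ)` — i.e.
`dim Hg(A₀) + dim Hg(A₁) − dim Hg(A₀ × A₁)` depends on the two types only through their two shadows.
[cite: Gordon1999HodgeAVSurvey, §3 Theorem, 7.5–7.7 and 9.4.3] [cite: Lang2002, VI §1 Thm. 1.1 and Cor. 1.6] -/
theorem cmTypeRank_add_cmTypeRank_eq_cmFamilyRank_add_one_add_finrank_shadow_inf_shadow {i₀ i₁ : I} (h01 : i₀ ≠ i₁)
    (hI : ∀ l, l = i₀ ∨ l = i₁) (Φ : ∀ i, CMType (K i)) [Algebra T₀ (K i₀)] [Algebra T₁ (K i₁)]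
    (htr₀ : ∀ (a : K i₀ →+* ℂ) (k : K i₀), a k ∈ normalClosure ℚ (K i₁) ℂ → k ∈ Set.range (algebraMap T₀ (K i₀)))
    (htr₁ : ∀ (b : K i₁ →+* ℂ) (k : K i₁), b k ∈ normalClosure ℚ (K i₀) ℂ → k ∈ Set.range (algebraMap T₁ (K i₁))) :
    cmTypeRank (Φ i₀) + cmTypeRank (Φ i₁) = CMAlgebra.cmFamilyRank Φ + 1 +
      Module.finrank ℚ (Submodule.span ℚ (Set.range fun y : T₀ →+* ℂ => fun g : ℂ ≃+* ℂ =>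
            ∑ t ∈ Finset.univ.filter (fun t : K i₀ →+* ℂ => t.comp (algebraMap T₀ (K i₀)) = g • y),
              antiVec (Φ i₀).1 (1 : ℂ ≃+* ℂ) t) ⊓
          Submodule.span ℚ (Set.range fun y : T₁ →+* ℂ => fun g : ℂ ≃+* ℂ =>
            ∑ t ∈ Finset.univ.filter (fun t : K i₁ →+* ℂ => t.comp (algebraMap T₁ (K i₁)) = g • y),
              antiVec (Φ i₁).1 (1 : ℂ ≃+* ℂ) t) : Submodule ℚ ((ℂ ≃+* ℂ) → ℚ)) := by
  haveI : ∀ i, Nonempty (K i →+* ℂ) := fun i => inferInstance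
  exact IrrOdd.typeRank_add_typeRank_eq_add_finrank_shadowCoeff_inf_shadowCoeff_of_fine (G := ℂ ≃+* ℂ)
    (E := fun i => K i →+* ℂ) (Φ := fun i => (Φ i).1) (fun i => isCMTypeWith_conj (Φ i)) hI h01
    (fun t : K i₀ →+* ℂ => t.comp (algebraMap T₀ (K i₀))) (fun t : K i₁ →+* ℂ => t.comp (algebraMap T₁ (K i₁)))
    (fun _ _ => rfl) (fun _ _ => rfl) (exists_stab_smul_eq_of_comp_eq_of_trace_le i₁ htr₀)
    (exists_stab_smul_eq_of_comp_eq_of_trace_le i₀ htr₁)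

end CM

end Summit.HodgeConjecture.CorCM

end
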